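import Mathlib

/-!
# Certified labels over an abstract canonisation process — definitions

Route `PneNP/SymmetryBudget`, item `NoHiddenOrder` (stmt-PneNP-14781); memo ANALYSIS-4 §2 (evidence on
the item).  The symmetric canonisation circuit of the memo has one gate group per LABEL `(U, X, λ)`;
this file fixes the abstract setting in which the LOGIC of that circuit — certification of children,
soundness, completeness — is kernel-checked (`SymmetryBudgetNoHiddenOrderCertifiedScheme.lean`):

* `Step`, `Process` — an abstract deterministic process on instances (for Corneil–Goldberg 1984:
  instance = (vertex set, ordered equitable partition); step = leaf / section node with its parts /
  individualisation node with its cell `A` and children `child x`); the only axiom used is that parts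
  have strictly smaller vertex sets.
* `Label` with `Label.part`, `Label.cand` (the two kinds of labels a group reads) and the syntactic
  `Label.measure`, strictly smaller for both (`measure_part_lt`, `measure_cand_lt`): the circuit is
  acyclic for syntactic reasons, whatever the labels denote.
* `Valuation` — values with a correctness predicate `Good I v` ("an ordered copy of `I`") and the
  pasting (P1) / lifting (P2) / leaf / choice operations with their axioms.
* `val P V dec adm g L` — THE VALUE OF GROUP `L`, by well-founded recursion on the measure, for an
  ARBITRARY decoding map `dec : Label → Option Inst` (in the memo: replay from the root, resolving each
  individualisation node by the unique `λ`-maximal already-named vertex of its cell), admissibility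
  predicate `adm` (low disorder) and value range `g`: children are CERTIFIED — a part label must decode
  to that part, a candidate `(U, X ∪ {x}, λ[x ↦ v])` must decode to the child `child x` — before their
  values are pasted / lifted and one is picked.
* `Reach P sel hv I₀` — the labels `(verts I, X, λ)` of the solution subtree of a child selector `sel`
  with recorded values `hv` (in the memo: the min-leaf selector and the pass-over heights).

Deliberately NOT here: the replay map itself and its equivariance, the disorder count of admissible
labels (`AdviceEntropy`, `CertifiedLabels.PassOverPath`), and the realisation of groups by symmetric
threshold gates (technology T4 of the memo).  Mathlib only; supports stmt-PneNP-14781.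
-/

-- `Summit.PneNP.PneNP.…` duplicates `PneNP` BY DESIGN (single-problem summit, D-0017 layout).
set_option linter.dupNamespace false

namespace Summit.PneNP.PneNP.Theorems

namespace CertifiedLabels

open Finset

/-- One macro-step of an abstract canonisation process at an instance: a LEAF; a SECTION node with its
set of parts; or an INDIVIDUALISATION node with its cell `A` and, for every `x`, the child instance
`child x` obtained by individualising `x` (only `x ∈ A` matter). -/
inductive Step (ι : Type*) (W : Type*)
  | leaf : Step ι W
  | andNode (parts : Finset ι) : Step ι W
  | orNode (cell : Finset W) (child : W → ι) : Step ι W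

/-- An abstract deterministic canonisation PROCESS on the window `W`: instances (in Corneil–Goldberg:
pairs (vertex set, ordered equitable partition)), their vertex sets, and the macro-step at each
instance; parts of a section node have strictly smaller vertex sets. -/
structure Process (W : Type*) where
  /-- instances -/
  Inst : Type*
  /-- the vertex set of an instance -/
  verts : Inst → Finset W
  /-- the macro-step at an instance -/
  step : Inst → Step Inst W
  /-- parts of a section node are proper subsets -/
  parts_ssubset : ∀ I ps, step I = .andNode ps → ∀ J ∈ ps, verts J ⊂ verts I

/-- A LABEL `(U, X, λ)`: intended vertex set, set of already-individualised vertices, values. -/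
structure Label (W : Type*) where
  /-- vertex set of the denoted instance -/
  U : Finset W
  /-- individualised vertices on the path to it -/
  X : Finset W
  /-- their values (an anti-layering of the pass-over forest, in the application) -/
  lam : W → ℕ

/-- VALUES with a correctness predicate: `Good I v` ("`v` is an ordered copy of the instance `I`"),
leaf values, pasting at section nodes (P1), lifting a child's value at individualisation nodes (P2),
and a choice `pick` from a finite set of values (lex-min) — with the four axioms the soundness proof
uses. -/
structure Valuation {W : Type*} (P : Process W) (Val : Type*) where
  /-- `v` is a correct value (ordered copy) of `I` -/
  Good : P.Inst → Val → Prop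
  /-- value of a leaf -/
  leafVal : P.Inst → Val
  /-- pasting the parts' values at a section node -/
  paste : P.Inst → (P.Inst → Val) → Val
  /-- lifting the value of the child `x` at an individualisation node -/
  lift : P.Inst → W → Val → Val
  /-- choosing one value from a finite set (lex-min) -/
  pick : Finset Val → Option Val
  /-- leaves are read off correctly -/
  good_leaf : ∀ I, P.step I = .leaf → Good I (leafVal I)
  /-- (P1) correct copies of all parts paste to a correct copy -/
  good_paste : ∀ I ps f, P.step I = .andNode ps → (∀ J ∈ ps, Good J (f J)) → Good I (paste I f)
  /-- (P2) a correct copy of the child `x ∈ A` lifts to a correct copy -/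
  good_lift : ∀ I A ch x v, P.step I = .orNode A ch → x ∈ A → Good (ch x) v → Good I (lift I x v)
  /-- the chosen value is one of the offered ones -/
  pick_mem : ∀ S v, pick S = some v → v ∈ S
  /-- something is chosen from a nonempty offer -/
  pick_ne_none : ∀ S, S.Nonempty → pick S ≠ none

variable {W : Type*}

namespace Label

/-- The label of the PART with vertex set `U'` (same `X`, same values). -/
def part (L : Label W) (U' : Finset W) : Label W := ⟨U', L.X, L.lam⟩

/-- The CANDIDATE label for the child `x` with value `v`: `(U, X ∪ {x}, λ[x ↦ v])`. -/
def cand [DecidableEq W] (L : Label W) (x : W) (v : ℕ) : Label W :=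
  ⟨L.U, insert x L.X, Function.update L.lam x v⟩

variable [Fintype W]

/-- The SYNTACTIC MEASURE of a label: lexicographic in (`|U|`, `−|X|`).  Groups read only groups of
strictly smaller measure, so the circuit is acyclic and `val` below is well defined. -/
def measure (L : Label W) : ℕ := L.U.card * (Fintype.card W + 1) + (Fintype.card W - L.X.card)

/-- Reading a part: smaller vertex set, smaller measure. -/
theorem measure_part_lt (L : Label W) {U' : Finset W} (h : U' ⊂ L.U) : (L.part U').measure < L.measure := by
  unfold measure part
  have h1 : U'.card < L.U.card := card_lt_card h
  have h2 : Fintype.card W - L.X.card ≤ Fintype.card W := Nat.sub_le _ _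
  have h3 : (U'.card + 1) * (Fintype.card W + 1) ≤ L.U.card * (Fintype.card W + 1) :=
    Nat.mul_le_mul_right _ h1
  dsimp only
  nlinarith

/-- Reading a candidate child label: one more individualised vertex, smaller measure. -/
theorem measure_cand_lt [DecidableEq W] (L : Label W) {x : W} (hx : x ∉ L.X) (v : ℕ) :
    (L.cand x v).measure < L.measure := by
  unfold measure cand
  have h1 : (insert x L.X).card = L.X.card + 1 := card_insert_of_notMem hx
  have h2 : (insert x L.X).card ≤ Fintype.card W := card_le_univ _
  simp only [h1] at h2 ⊢
  omega

end Label

variable [DecidableEq W] (P : Process W) {Val : Type*} [DecidableEq Val]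
  (V : Valuation P Val) (dec : Label W → Option P.Inst) (adm : Label W → Prop) (g : ℕ)

open scoped Classical in
/-- THE VALUE OF A GROUP (ANALYSIS-4 §2).  `dec` is the decoding (replay) map, `adm` the admissible
(low-disorder) labels, `g` the value range.  Group `L`: if `L` decodes to `I` — LEAF: the leaf value;
SECTION node: read the part groups `L.part (verts J)`, CERTIFY each (it must decode to `J` and carry
a value) and paste, else `none`; INDIVIDUALISATION node with cell `A`: for every `x ∈ A ∖ X` and
`v < g` take the candidate `L.cand x v`, keep it if admissible, CERTIFIED (decodes to the child
`child x`) and valued, lift its value, and `pick` among the kept ones. -/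
noncomputable def val [Fintype W] : Label W → Option Val
  | L =>
    match dec L with
    | none => none
    | some I =>
      match P.step I with
      | .leaf => some (V.leafVal I)
      | .andNode ps =>
          let r : P.Inst → Option Val := fun J =>
            if _hJU : P.verts J ⊂ L.U then
              (if dec (L.part (P.verts J)) = some J then val (L.part (P.verts J)) else none)
            else none
          if ∀ J ∈ ps, (r J).isSome = true then some (V.paste I fun J => (r J).getD (V.leafVal J))
          else none
      | .orNode A ch =>
          V.pick ((A.filter fun x => x ∉ L.X).attach.biUnion fun x =>
            (range g).biUnion fun v =>
              if adm (L.cand x.1 v) ∧ dec (L.cand x.1 v) = some (ch x.1) then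
                ((val (L.cand x.1 v)).map (V.lift I x.1)).toFinset
              else ∅)
termination_by L => L.measure
decreasing_by
  all_goals first
    | exact Label.measure_part_lt _ ‹_›
    | exact Label.measure_cand_lt _ (mem_filter.1 (Subtype.prop ‹_›)).2 _

/-- The nodes of the SOLUTION SUBTREE of the selector `sel` with values `hv`, reached from the instance
`I₀`, together with the data `(X, λ)` of their labels: all parts at section nodes, the child `sel I`
at individualisation nodes, where the value `hv I` is recorded for the new vertex `sel I`. -/
inductive Reach (sel : P.Inst → W) (hv : P.Inst → ℕ) (I₀ : P.Inst) : P.Inst → Finset W → (W → ℕ) → Prop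
  | root : Reach sel hv I₀ I₀ ∅ (fun _ => 0)
  | part {I : P.Inst} {X : Finset W} {lam : W → ℕ} {ps : Finset P.Inst} {J : P.Inst} :
      Reach sel hv I₀ I X lam → P.step I = .andNode ps → J ∈ ps → Reach sel hv I₀ J X lam
  | child {I : P.Inst} {X : Finset W} {lam : W → ℕ} {A : Finset W} {ch : W → P.Inst} :
      Reach sel hv I₀ I X lam → P.step I = .orNode A ch →
        Reach sel hv I₀ (ch (sel I)) (insert (sel I) X) (Function.update lam (sel I) (hv I))

end CertifiedLabels

end Summit.PneNP.PneNP.Theorems
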